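import Summits.Ventures.DiscreteObjects.Hadamard.Order6TypeICore
import Summits.Ventures.DiscreteObjects.Hadamard.Order6TypeIPrep
import Summits.Ventures.DiscreteObjects.Hadamard.Order6SixCycles
import Summits.Ventures.DiscreteObjects.Hadamard.InvolutionTools

/-!
# H(4q), q ≡ 11 (mod 12): order-6 automorphisms with TYPE-I cube have an even number of 6-cycles (transfer)

Framing: lottery ticket; floor = certified bounds/negative ranges.

Cell pub-namedobj (venture DiscreteObjects), target (H), hadamard gen 14.  Transfer from an arbitrary signed automorphism
`(π, κ, d, e)` of a Hadamard matrix of order `4q` (`q ≡ 11 (mod 12)` prime) with `π⁶ = κ⁶ = 1` and TYPE-I sign data —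
every point satisfies: the product of `d` over `i, …, π⁵ i` is `1`; `π² i = i ⇒ d i · d (π i) = 1`;
`π³ i = i ⇒ d i · d (π i) · d (π² i) = 1` (fixed points have sign `+1`, `2`- and `3`-cycles sign product `+1`, `6`-cycles sign
product `+1`), likewise for `(κ, e)` — to the block normal form of `Order6TypeICore`: orbit minima of the `6`-cycles
(`perm6C_bijective`) on rows and columns, the complement kept as a subtype with the restricted permutation; the numbers of
`6`-cycle points agree on rows and columns by the trace lemma applied to `g`, `g²`, `g³` and `card_not_six_eq`; re-signing
`δ (p, c) = ∏_{k<p} d (π^k c)` on the `6`-cycles only.  Result **`hadamard4q_six_typeI`**: `12 ∣ #{i | i on a 6-cycle of π}`.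
Ours; no `sorry`.
-/

namespace Summit.Ventures.DiscreteObjects.Hadamard

open Finset BigOperators Matrix

open Literature.Combinatorics.Designs.GoethalsSeidel (IsHadamardMatrix)

section transferTypeIord
variable {ι : Type*} [Fintype ι] [LinearOrder ι]

/-- **Type-I transfer** (ordered index type). -/
theorem hadamard4q_six_typeI_ord {q : ℕ} (hq : q.Prime) (hq12 : q % 12 = 11) {H : Matrix ι ι ℤ}
    (hH : IsHadamardMatrix H) (hι : Fintype.card ι = 4 * q) {π κ : Equiv.Perm ι} {d e : ι → ℤ}
    (haut : IsSignedAut H π κ d e)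
    (hπ6 : ∀ i, π (π (π (π (π (π i))))) = i) (hκ6 : ∀ j, κ (κ (κ (κ (κ (κ j))))) = j)
    (hd6 : ∀ i, d i * d (π i) * d (π (π i)) * d (π (π (π i))) * d (π (π (π (π i)))) *
      d (π (π (π (π (π i))))) = 1)
    (hd2 : ∀ i, π (π i) = i → d i * d (π i) = 1)
    (hd3 : ∀ i, π (π (π i)) = i → d i * d (π i) * d (π (π i)) = 1)
    (he6 : ∀ j, e j * e (κ j) * e (κ (κ j)) * e (κ (κ (κ j))) * e (κ (κ (κ (κ j)))) *
      e (κ (κ (κ (κ (κ j))))) = 1)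
    (he2 : ∀ j, κ (κ j) = j → e j * e (κ j) = 1)
    (he3 : ∀ j, κ (κ (κ j)) = j → e j * e (κ j) * e (κ (κ j)) = 1) :
    12 ∣ (univ.filter (fun i => π (π i) ≠ i ∧ π (π (π i)) ≠ i)).card := by
  have hd := haut.1
  have he := haut.2.1
  have hA := haut.2.2
  have pm_mul : ∀ {a b : ℤ}, (a = 1 ∨ a = -1) → (b = 1 ∨ b = -1) → (a * b = 1 ∨ a * b = -1) := by
    intro a b ha hb
    rcases ha with h | h <;> rcases hb with h' | h' <;> simp [h, h']
  have hq0 : 0 < q := hq.pos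
  have hcardι : (Fintype.card ι : ℤ) ≠ 0 := by rw [hι]; push_cast; positivity
  -- fixed points have sign +1
  have hd1 : ∀ i, π i = i → d i = 1 := by
    intro i h1
    have h := hd3 i (by rw [h1, h1, h1])
    rw [h1, h1, pm_mul_self (hd i), one_mul] at h
    exact h
  have he1 : ∀ j, κ j = j → e j = 1 := by
    intro j h1
    have h := he3 j (by rw [h1, h1, h1])
    rw [h1, h1, pm_mul_self (he j), one_mul] at h
    exact h
  -- orbit structure
  set R₆ := univ.filter (fun c => (π (π c) ≠ c ∧ π (π (π c)) ≠ c) ∧ ∀ p : Fin 6, c ≤ (π ^ (p : ℕ)) c) with hR₆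
  set K₆ := univ.filter (fun c => (κ (κ c) ≠ c ∧ κ (κ (κ c)) ≠ c) ∧ ∀ p : Fin 6, c ≤ (κ ^ (p : ℕ)) c) with hK₆
  set Nr := univ.filter (fun i => ¬ (π (π i) ≠ i ∧ π (π (π i)) ≠ i)) with hNr
  set Nc := univ.filter (fun j => ¬ (κ (κ j) ≠ j ∧ κ (κ (κ j)) ≠ j)) with hNc
  let φr : (Fin 6 × {c // c ∈ R₆}) ⊕ {i // i ∈ Nr} → ι := Sum.elim (fun x => (π ^ (x.1 : ℕ)) x.2.1) (fun x => x.1)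
  let φc : (Fin 6 × {c // c ∈ K₆}) ⊕ {j // j ∈ Nc} → ι := Sum.elim (fun x => (κ ^ (x.1 : ℕ)) x.2.1) (fun x => x.1)
  have hbr : Function.Bijective φr := perm6C_bijective π hπ6
  have hbc : Function.Bijective φc := perm6C_bijective κ hκ6
  let eR : (Fin 6 × {c // c ∈ R₆}) ⊕ {i // i ∈ Nr} ≃ ι := Equiv.ofBijective φr hbr
  let eC' : (Fin 6 × {c // c ∈ K₆}) ⊕ {j // j ∈ Nc} ≃ ι := Equiv.ofBijective φc hbc
  -- counting: the numbers of 6-cycle points agree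
  have hsixR : (univ.filter (fun i => π (π i) ≠ i ∧ π (π (π i)) ≠ i)).card = 6 * R₆.card := perm6C_card_six π hπ6
  have hsixC : (univ.filter (fun j => κ (κ j) ≠ j ∧ κ (κ (κ j)) ≠ j)).card = 6 * K₆.card := perm6C_card_six κ hκ6
  have hsplitR := Finset.card_filter_add_card_filter_not (s := (univ : Finset ι))
    (fun i => π (π i) ≠ i ∧ π (π (π i)) ≠ i)
  have hsplitC := Finset.card_filter_add_card_filter_not (s := (univ : Finset ι))
    (fun j => κ (κ j) ≠ j ∧ κ (κ (κ j)) ≠ j)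
  rw [Finset.card_univ] at hsplitR hsplitC
  -- trace lemma on g, g², g³
  have haut2 : IsSignedAut H (π ^ 2) (κ ^ 2) (fun i => d i * d (π i)) (fun j => e j * e (κ j)) := by
    refine ⟨fun i => pm_mul (hd i) (hd (π i)), fun j => pm_mul (he j) (he (κ j)), fun i j => ?_⟩
    have p2π : (π ^ 2) i = π (π i) := by simp [pow_two]
    have p2κ : (κ ^ 2) j = κ (κ j) := by simp [pow_two]
    rw [p2π, p2κ, hA, hA]
    ring
  have haut3 : IsSignedAut H (π ^ 3) (κ ^ 3) (fun i => d i * d (π i) * d (π (π i)))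
      (fun j => e j * e (κ j) * e (κ (κ j))) := by
    refine ⟨fun i => pm_mul (pm_mul (hd i) (hd (π i))) (hd (π (π i))),
      fun j => pm_mul (pm_mul (he j) (he (κ j))) (he (κ (κ j))), fun i j => ?_⟩
    have p3π : (π ^ 3) i = π (π (π i)) := by simp [pow_succ]
    have p3κ : (κ ^ 3) j = κ (κ (κ j)) := by simp [pow_succ]
    rw [p3π, p3κ, hA, hA, hA]
    ring
  have htr1 := signedAut_trace hH hcardι haut
  have htr2 := signedAut_trace hH hcardι haut2
  have htr3 := signedAut_trace hH hcardι haut3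
  have hfilt2R : univ.filter (fun i => (π ^ 2) i = i) = univ.filter (fun i => π (π i) = i) := by
    ext i; simp [pow_two]
  have hfilt2C : univ.filter (fun j => (κ ^ 2) j = j) = univ.filter (fun j => κ (κ j) = j) := by
    ext j; simp [pow_two]
  have hfilt3R : univ.filter (fun i => (π ^ 3) i = i) = univ.filter (fun i => π (π (π i)) = i) := by
    ext i; simp [pow_succ]
  have hfilt3C : univ.filter (fun j => (κ ^ 3) j = j) = univ.filter (fun j => κ (κ (κ j)) = j) := by
    ext j; simp [pow_succ]
  rw [hfilt2R, hfilt2C] at htr2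
  rw [hfilt3R, hfilt3C] at htr3
  have hsum1R : ∑ i ∈ univ.filter (fun i => π i = i), d i = ((univ.filter (fun i => π i = i)).card : ℤ) := by
    rw [Finset.sum_congr rfl (fun i hi => hd1 i (mem_filter.mp hi).2)]; simp
  have hsum1C : ∑ j ∈ univ.filter (fun j => κ j = j), e j = ((univ.filter (fun j => κ j = j)).card : ℤ) := by
    rw [Finset.sum_congr rfl (fun j hj => he1 j (mem_filter.mp hj).2)]; simp
  have hsum2R : ∑ i ∈ univ.filter (fun i => π (π i) = i), d i * d (π i) =
      ((univ.filter (fun i => π (π i) = i)).card : ℤ) := by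
    rw [Finset.sum_congr rfl (fun i hi => hd2 i (mem_filter.mp hi).2)]; simp
  have hsum2C : ∑ j ∈ univ.filter (fun j => κ (κ j) = j), e j * e (κ j) =
      ((univ.filter (fun j => κ (κ j) = j)).card : ℤ) := by
    rw [Finset.sum_congr rfl (fun j hj => he2 j (mem_filter.mp hj).2)]; simp
  have hsum3R : ∑ i ∈ univ.filter (fun i => π (π (π i)) = i), d i * d (π i) * d (π (π i)) =
      ((univ.filter (fun i => π (π (π i)) = i)).card : ℤ) := by
    rw [Finset.sum_congr rfl (fun i hi => hd3 i (mem_filter.mp hi).2)]; simp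
  have hsum3C : ∑ j ∈ univ.filter (fun j => κ (κ (κ j)) = j), e j * e (κ j) * e (κ (κ j)) =
      ((univ.filter (fun j => κ (κ (κ j)) = j)).card : ℤ) := by
    rw [Finset.sum_congr rfl (fun j hj => he3 j (mem_filter.mp hj).2)]; simp
  have hfix1 : (univ.filter (fun i => π i = i)).card = (univ.filter (fun j => κ j = j)).card := by
    have h := htr1; rw [hsum1R, hsum1C] at h; exact_mod_cast h
  have hfix2 : (univ.filter (fun i => π (π i) = i)).card = (univ.filter (fun j => κ (κ j) = j)).card := by
    have h := htr2; rw [hsum2R, hsum2C] at h; exact_mod_cast h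
  have hfix3 : (univ.filter (fun i => π (π (π i)) = i)).card = (univ.filter (fun j => κ (κ (κ j)) = j)).card := by
    have h := htr3; rw [hsum3R, hsum3C] at h; exact_mod_cast h
  have hNR := card_not_six_eq π
  have hNC := card_not_six_eq κ
  have hN : Nr.card = Nc.card := by rw [hNr, hNc]; omega
  have h66 : R₆.card = K₆.card := by omega
  obtain ⟨g₆⟩ : Nonempty ({c // c ∈ R₆} ≃ {c // c ∈ K₆}) :=
    Fintype.card_eq.mp (by rw [Fintype.card_coe, Fintype.card_coe]; exact h66)
  obtain ⟨gC⟩ : Nonempty ({i // i ∈ Nr} ≃ {j // j ∈ Nc}) :=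
    Fintype.card_eq.mp (by rw [Fintype.card_coe, Fintype.card_coe]; exact hN)
  let eC : (Fin 6 × {c // c ∈ R₆}) ⊕ {i // i ∈ Nr} ≃ ι := (Equiv.sumCongr ((Equiv.refl (Fin 6)).prodCongr g₆) gC).trans eC'
  -- restricted permutations on the complements
  have hNrinv : ∀ i, (π i ∈ Nr) ↔ (i ∈ Nr) := by
    intro i
    rw [hNr, mem_filter, mem_filter, six_cycle_invariant]
    simp
  have hNcinv : ∀ j, (κ j ∈ Nc) ↔ (j ∈ Nc) := by
    intro j
    rw [hNc, mem_filter, mem_filter, six_cycle_invariant]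
    simp
  set πC : Equiv.Perm {i // i ∈ Nr} := π.subtypePerm hNrinv with hπCdef
  set κC : Equiv.Perm {j // j ∈ Nc} := κ.subtypePerm hNcinv with hκCdef
  set τc : Equiv.Perm {i // i ∈ Nr} := (gC.trans κC).trans gC.symm with hτcdef
  have hπC : ∀ i : {i // i ∈ Nr}, (πC i : ι) = π i := fun i => rfl
  have hκC : ∀ j : {j // j ∈ Nc}, (κC j : ι) = κ j := fun j => rfl
  have hτc : ∀ i : {i // i ∈ Nr}, τc i = gC.symm (κC (gC i)) := fun i => rfl
  -- the standard row/column permutations and their intertwining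
  set σr : Equiv.Perm ((Fin 6 × {c // c ∈ R₆}) ⊕ {i // i ∈ Nr}) :=
    Equiv.sumCongr ((finRotate 6).prodCongr (Equiv.refl _)) πC with hσrdef
  set σc : Equiv.Perm ((Fin 6 × {c // c ∈ R₆}) ⊕ {i // i ∈ Nr}) :=
    Equiv.sumCongr ((finRotate 6).prodCongr (Equiv.refl _)) τc with hσcdef
  have hσrl : ∀ (p : Fin 6) (c : {c // c ∈ R₆}), σr (Sum.inl (p, c)) = Sum.inl (p + 1, c) := by
    intro p c; simp [hσrdef]
  have hσrr : ∀ (i : {i // i ∈ Nr}), σr (Sum.inr i) = Sum.inr (πC i) := by intro i; simp [hσrdef]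
  have hσcl : ∀ (p : Fin 6) (c : {c // c ∈ R₆}), σc (Sum.inl (p, c)) = Sum.inl (p + 1, c) := by
    intro p c; simp [hσcdef]
  have hσcr : ∀ (i : {i // i ∈ Nr}), σc (Sum.inr i) = Sum.inr (τc i) := by intro i; simp [hσcdef]
  have heRl : ∀ (p : Fin 6) (c : {c // c ∈ R₆}), eR (Sum.inl (p, c)) = (π ^ (p : ℕ)) c.1 := fun _ _ => rfl
  have heRr : ∀ (i : {i // i ∈ Nr}), eR (Sum.inr i) = i.1 := fun _ => rfl
  have heCl : ∀ (p : Fin 6) (c : {c // c ∈ R₆}), eC (Sum.inl (p, c)) = (κ ^ (p : ℕ)) (g₆ c).1 := fun _ _ => rfl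
  have heCr : ∀ (i : {i // i ∈ Nr}), eC (Sum.inr i) = (gC i).1 := fun _ => rfl
  have heR : ∀ x, eR (σr x) = π (eR x) := by
    rintro (⟨p, c⟩ | i)
    · rw [hσrl, heRl, heRl]
      fin_cases p <;> simp [pow_succ, hπ6]
    · rw [hσrr, heRr, heRr, hπC]
  have heC : ∀ x, eC (σc x) = κ (eC x) := by
    rintro (⟨p, c⟩ | i)
    · rw [hσcl, heCl, heCl]
      fin_cases p <;> simp [pow_succ, hκ6]
    · rw [hσcr, heCr, heCr, hτc, Equiv.apply_symm_apply, hκC]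
  -- re-signing (6-cycles only)
  have hprodπ : ∀ (n : ℕ) (c : ι), (∏ k ∈ range n, d ((π ^ k) c)) = 1 ∨ (∏ k ∈ range n, d ((π ^ k) c)) = -1 := by
    intro n c
    induction n with
    | zero => simp
    | succ n ih => rw [Finset.prod_range_succ]; exact pm_mul ih (hd _)
  have hprodκ : ∀ (n : ℕ) (c : ι), (∏ k ∈ range n, e ((κ ^ k) c)) = 1 ∨ (∏ k ∈ range n, e ((κ ^ k) c)) = -1 := by
    intro n c
    induction n with
    | zero => simp
    | succ n ih => rw [Finset.prod_range_succ]; exact pm_mul ih (he _)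
  set δ : (Fin 6 × {c // c ∈ R₆}) ⊕ {i // i ∈ Nr} → ℤ :=
    Sum.elim (fun x => ∏ k ∈ range (x.1 : ℕ), d ((π ^ k) x.2.1)) (fun _ => 1) with hδdef
  set ε : (Fin 6 × {c // c ∈ R₆}) ⊕ {i // i ∈ Nr} → ℤ :=
    Sum.elim (fun x => ∏ k ∈ range (x.1 : ℕ), e ((κ ^ k) (g₆ x.2).1)) (fun _ => 1) with hεdef
  set dr : {i // i ∈ Nr} → ℤ := fun i => d i.1 with hdrdef
  set dc : {i // i ∈ Nr} → ℤ := fun i => e (gC i).1 with hdcdef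
  set d₀r : (Fin 6 × {c // c ∈ R₆}) ⊕ {i // i ∈ Nr} → ℤ := Sum.elim (fun _ => 1) dr with hd₀rdef
  set d₀c : (Fin 6 × {c // c ∈ R₆}) ⊕ {i // i ∈ Nr} → ℤ := Sum.elim (fun _ => 1) dc with hd₀cdef
  have hδpm : ∀ x, δ x = 1 ∨ δ x = -1 := by
    rintro (⟨p, c⟩ | i)
    · exact hprodπ _ _
    · left; rfl
  have hεpm : ∀ x, ε x = 1 ∨ ε x = -1 := by
    rintro (⟨p, c⟩ | i)
    · exact hprodκ _ _
    · left; rfl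
  have hδkey : ∀ x, δ (σr x) * d (eR x) = d₀r x * δ x := by
    rintro (⟨p, c⟩ | i)
    · rw [hσrl, heRl]
      simp only [hδdef, hd₀rdef, Sum.elim_inl]
      have s0 := pm_mul_self (hd c.1)
      have s1 := pm_mul_self (hd (π c.1))
      have s2 := pm_mul_self (hd (π (π c.1)))
      have s3 := pm_mul_self (hd (π (π (π c.1))))
      have s4 := pm_mul_self (hd (π (π (π (π c.1)))))
      have hn := hd6 c.1
      fin_cases p <;> simp [Finset.prod_range_succ, pow_succ]
      · linear_combination s0
      · linear_combination (d c.1) * s1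
      · linear_combination (d c.1 * d (π c.1)) * s2
      · linear_combination (d c.1 * d (π c.1) * d (π (π c.1))) * s3
      · linear_combination (d c.1 * d (π c.1) * d (π (π c.1)) * d (π (π (π c.1)))) * s4
      · have hX := pm_mul_self (pm_mul (pm_mul (pm_mul (pm_mul (hd c.1) (hd (π c.1))) (hd (π (π c.1))))
          (hd (π (π (π c.1))))) (hd (π (π (π (π c.1))))))
        linear_combination (d c.1 * d (π c.1) * d (π (π c.1)) * d (π (π (π c.1))) * d (π (π (π (π c.1))))) * hn
          - (d (π (π (π (π (π c.1)))))) * hX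
    · rw [hσrr, heRr]
      simp only [hδdef, hd₀rdef, Sum.elim_inr, hdrdef]
      ring
  have hεkey : ∀ x, ε (σc x) * e (eC x) = d₀c x * ε x := by
    rintro (⟨p, c⟩ | i)
    · rw [hσcl, heCl]
      simp only [hεdef, hd₀cdef, Sum.elim_inl]
      have s0 := pm_mul_self (he (g₆ c).1)
      have s1 := pm_mul_self (he (κ (g₆ c).1))
      have s2 := pm_mul_self (he (κ (κ (g₆ c).1)))
      have s3 := pm_mul_self (he (κ (κ (κ (g₆ c).1))))
      have s4 := pm_mul_self (he (κ (κ (κ (κ (g₆ c).1)))))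
      have hn := he6 (g₆ c).1
      fin_cases p <;> simp [Finset.prod_range_succ, pow_succ]
      · linear_combination s0
      · linear_combination (e (g₆ c).1) * s1
      · linear_combination (e (g₆ c).1 * e (κ (g₆ c).1)) * s2
      · linear_combination (e (g₆ c).1 * e (κ (g₆ c).1) * e (κ (κ (g₆ c).1))) * s3
      · linear_combination (e (g₆ c).1 * e (κ (g₆ c).1) * e (κ (κ (g₆ c).1)) * e (κ (κ (κ (g₆ c).1)))) * s4
      · have hX := pm_mul_self (pm_mul (pm_mul (pm_mul (pm_mul (he (g₆ c).1) (he (κ (g₆ c).1)))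
          (he (κ (κ (g₆ c).1)))) (he (κ (κ (κ (g₆ c).1))))) (he (κ (κ (κ (κ (g₆ c).1))))))
        linear_combination (e (g₆ c).1 * e (κ (g₆ c).1) * e (κ (κ (g₆ c).1)) * e (κ (κ (κ (g₆ c).1))) *
          e (κ (κ (κ (κ (g₆ c).1))))) * hn - (e (κ (κ (κ (κ (κ (g₆ c).1)))))) * hX
    · rw [hσcr, heCr]
      simp only [hεdef, hd₀cdef, Sum.elim_inr, hdcdef, hτc]
      ring
  -- the transported, re-signed matrix
  set H' : Matrix ((Fin 6 × {c // c ∈ R₆}) ⊕ {i // i ∈ Nr}) ((Fin 6 × {c // c ∈ R₆}) ⊕ {i // i ∈ Nr}) ℤ :=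
    fun x y => δ x * ε y * H (eR x) (eC y) with hH'def
  have hH' : IsHadamardMatrix H' := by
    refine ⟨fun x y => ?_, ?_⟩
    · rw [hH'def]
      exact pm_mul (pm_mul (hδpm x) (hεpm y)) (hH.1 _ _)
    · ext x x'
      rw [Matrix.mul_apply, Matrix.smul_apply, Matrix.one_apply]
      simp only [hH'def, transpose_apply, smul_eq_mul]
      have e1 : ∑ y, δ x * ε y * H (eR x) (eC y) * (δ x' * ε y * H (eR x') (eC y))
          = δ x * δ x' * ∑ y, H (eR x) (eC y) * H (eR x') (eC y) := by
        rw [Finset.mul_sum]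
        refine Finset.sum_congr rfl fun y _ => ?_
        have := pm_mul_self (hεpm y)
        linear_combination (δ x * δ x' * H (eR x) (eC y) * H (eR x') (eC y)) * this
      rw [e1, Equiv.sum_comp eC (fun j => H (eR x) j * H (eR x') j)]
      rw [Fintype.card_congr eR]
      by_cases hxx : x = x'
      · subst hxx
        rw [hadamard_row_self H hH, if_pos rfl, pm_mul_self (hδpm x), one_mul, mul_one]
      · have hne : eR x ≠ eR x' := fun h => hxx (eR.injective h)
        rw [hadamard_row_orth H hH hne, if_neg hxx, mul_zero, mul_zero]
  have haut' : IsSignedAut H' σr σc d₀r d₀c := by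
    refine ⟨fun x => ?_, fun x => ?_, fun x y => ?_⟩
    · rcases x with ⟨p, c⟩ | i
      · left; rfl
      · exact hd i.1
    · rcases x with ⟨p, c⟩ | i
      · left; rfl
      · exact he (gC i).1
    · show δ (σr x) * ε (σc y) * H (eR (σr x)) (eC (σc y)) = d₀r x * d₀c y * (δ x * ε y * H (eR x) (eC y))
      rw [heR, heC, hA]
      have h1 := hδkey x
      have h2 := hεkey y
      linear_combination (ε (σc y) * e (eC y) * H (eR x) (eC y)) * h1 + (d₀r x * δ x * H (eR x) (eC y)) * h2
  have hcard' : Fintype.card ((Fin 6 × {c // c ∈ R₆}) ⊕ {i // i ∈ Nr}) = 4 * q := by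
    rw [Fintype.card_congr eR, hι]
  -- the C-part hypotheses of the core
  have htyper : ∀ i : {i // i ∈ Nr}, (πC (πC i) = i ∧ dr i * dr (πC i) = 1) ∨
      (πC (πC (πC i)) = i ∧ dr i * dr (πC i) * dr (πC (πC i)) = 1) := by
    intro i
    have hi := (mem_filter.mp i.2).2
    by_cases h2 : π (π i.1) = i.1
    · left
      exact ⟨Subtype.ext (by rw [hπC, hπC, h2]), by simp only [hdrdef, hπC]; exact hd2 i.1 h2⟩
    · right
      have h3 : π (π (π i.1)) = i.1 := by
        by_contra h3; exact hi ⟨h2, h3⟩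
      exact ⟨Subtype.ext (by rw [hπC, hπC, hπC, h3]), by simp only [hdrdef, hπC]; exact hd3 i.1 h3⟩
  have htypec : ∀ i : {i // i ∈ Nr}, (τc (τc i) = i ∧ dc i * dc (τc i) = 1) ∨
      (τc (τc (τc i)) = i ∧ dc i * dc (τc i) * dc (τc (τc i)) = 1) := by
    intro i
    have hj := (mem_filter.mp (gC i).2).2
    have eτ1 : gC (τc i) = κC (gC i) := by rw [hτc, Equiv.apply_symm_apply]
    have eτ2 : gC (τc (τc i)) = κC (κC (gC i)) := by rw [hτc, Equiv.apply_symm_apply, eτ1]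
    have eτ3 : gC (τc (τc (τc i))) = κC (κC (κC (gC i))) := by rw [hτc, Equiv.apply_symm_apply, eτ2]
    by_cases h2 : κ (κ (gC i).1) = (gC i).1
    · left
      refine ⟨gC.injective (eτ2.trans (Subtype.ext (by rw [hκC, hκC, h2]))), ?_⟩
      simp only [hdcdef, eτ1, hκC]
      exact he2 _ h2
    · right
      have h3 : κ (κ (κ (gC i).1)) = (gC i).1 := by
        by_contra h3; exact hj ⟨h2, h3⟩
      refine ⟨gC.injective (eτ3.trans (Subtype.ext (by rw [hκC, hκC, hκC, h3]))), ?_⟩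
      simp only [hdcdef, eτ1, eτ2, hκC]
      exact he3 _ h3
  obtain ⟨hQr6, hQrrel⟩ := typeI_signedPerm_facts (F := QuadraticAlgebra ℚ 3 0) πC dr htyper _ rfl
  obtain ⟨hQc6, hQcrel⟩ := typeI_signedPerm_facts (F := QuadraticAlgebra ℚ 3 0) τc dc htypec _ rfl
  -- conclusion: |R₆| is even
  rcases Nat.even_or_odd R₆.card with heven | hodd
  · obtain ⟨k, hk⟩ := heven
    rw [hsixR, hk]
    exact ⟨k, by ring⟩
  · exfalso
    have hA6 : Odd (Fintype.card {c // c ∈ R₆}) := by rw [Fintype.card_coe]; exact hodd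
    exact no_hadamard4q_six_typeI_blockform hq hq12 hcard' hA6 πC τc dr dc _ _ rfl rfl hQr6 hQrrel hQc6 hQcrel
      H' hH' haut'

end transferTypeIord

section transferTypeI
variable {ι : Type*} [Fintype ι] [DecidableEq ι]

/-- **Type-I transfer**, arbitrary index type: under type-I sign data (all cycle sign products `+1`, fixed points `+1`),
`12 ∣ #{i | i on a 6-cycle of π}`. -/
theorem hadamard4q_six_typeI {q : ℕ} (hq : q.Prime) (hq12 : q % 12 = 11) {H : Matrix ι ι ℤ}
    (hH : IsHadamardMatrix H) (hι : Fintype.card ι = 4 * q) {π κ : Equiv.Perm ι} {d e : ι → ℤ}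
    (haut : IsSignedAut H π κ d e)
    (hπ6 : ∀ i, π (π (π (π (π (π i))))) = i) (hκ6 : ∀ j, κ (κ (κ (κ (κ (κ j))))) = j)
    (hd6 : ∀ i, d i * d (π i) * d (π (π i)) * d (π (π (π i))) * d (π (π (π (π i)))) *
      d (π (π (π (π (π i))))) = 1)
    (hd2 : ∀ i, π (π i) = i → d i * d (π i) = 1)
    (hd3 : ∀ i, π (π (π i)) = i → d i * d (π i) * d (π (π i)) = 1)
    (he6 : ∀ j, e j * e (κ j) * e (κ (κ j)) * e (κ (κ (κ j))) * e (κ (κ (κ (κ j)))) *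
      e (κ (κ (κ (κ (κ j))))) = 1)
    (he2 : ∀ j, κ (κ j) = j → e j * e (κ j) = 1)
    (he3 : ∀ j, κ (κ (κ j)) = j → e j * e (κ j) * e (κ (κ j)) = 1) :
    12 ∣ (univ.filter (fun i => π (π i) ≠ i ∧ π (π (π i)) ≠ i)).card := by
  classical
  letI : LinearOrder ι := LinearOrder.lift' (Fintype.equivFin ι) (Fintype.equivFin ι).injective
  have h := hadamard4q_six_typeI_ord hq hq12 (H := H) (by convert hH) hι haut hπ6 hκ6 hd6 hd2 hd3 he6 he2 he3
  convert h

end transferTypeI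

end Summit.Ventures.DiscreteObjects.Hadamard
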